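import Summits.SmoothPoincare4.SmoothPoincare4.Theorems.EntropyRungChangGurskyYangStubGradientEstimatesEvolution
import Summits.SmoothPoincare4.SmoothPoincare4.Theorems.EntropyRungChangGurskyYangStubGradientEstimatesSmooth
import Summits.SmoothPoincare4.SmoothPoincare4.Theorems.EntropyRungChangGurskyYangStubGradientEstimatesBound
import Summits.SmoothPoincare4.SmoothPoincare4.Theorems.EntropyRungChangGurskyYangStubGradientEstimatesDecay
import Summits.SmoothPoincare4.SmoothPoincare4.Theorems.EntropyRungChangGurskyYangStubRoundnessRateAux
import HarnessLib

/-!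
# Hamilton's gradient estimates for the scalar curvature along a pinched Ricci flow
(stub `stub_gradientEstimates` of line `margerin-cone-hamilton-rails`, crux `EntropyRung.ChangGurskyYang`,
item stmt-SmoothPoincare4-10834)

STUB 4.B1 of the line — Hamilton 1982, Thm. 11.1 (for every `η > 0`, `|∇R|² ≤ ηR³ + C(η)`) and
Lemma 17.4 in unnormalised clothes (`|∇R|² ≤ C(T−t)^{δ−3}` under the Type-I sandwich
`c₁ ≤ (T−t)R ≤ c₂`), in dimension 4 (Huisken 1985, Thm. 4.1), for a Ricci flow of Riemannian
metrics on `[0, T)` on a closed 4-manifold with the invariant pinching `m ≤ R`,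
`|W|² + 2|E|² ≤ K R^{2−τ}`. This file is the sorry-free ASSEMBLY of the four landed pieces:

* H0 `helper_hamiltonEvolution` (`…StubGradientEstimatesEvolution.lean`): the evolution inequality
  `∂ₜu ≤ Δu + (2η−1)|∇R|² + N(64√|Rm|² + R)|E|² − 4ηR|Ric|²` of `u = |∇R|²/R + N|E|² − ηR²` on the
  manifold (transport of the coordinate computation `CoordHamiltonGradientFunction.lean`);
* H1/H2 `helper_hamiltonSmoothGradSq`, `helper_hamiltonSmoothRicciNormSq` (`…Smooth.lean`): joint
  smoothness of `|∇R|²`, `|Ric|²` on space-time;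
* H3 `helper_gradientBound_of_evolution` (`…Bound.lean`): Thm. 11.1 by the weak maximum principle;
* H4 `helper_gradientDecay_of_evolution` (`…Decay.lean`): Lemma 17.4 by the weak maximum principle
  along the restarted flows.

## References

* R. S. Hamilton, *Three-manifolds with positive Ricci curvature*, J. Differential Geom. 17 (1982)
  255–306, §11, Thm. 11.1, Lemmas 11.5–11.9; §17, Lemma 17.4. [Hamilton1982]
* G. Huisken, *Ricci deformation of the metric on a Riemannian manifold*, J. Differential Geom. 21
  (1985) 47–62, §4, Thm. 4.1, Lemma 4.3. [Huisken1985]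
-/

noncomputable section

-- every `Summit.SmoothPoincare4.SmoothPoincare4.…` name repeats the summit = sub-problem segment (D-0017 layout)
set_option linter.dupNamespace false

open Set Function Filter
open scoped Manifold ContDiff Topology

namespace Summit.SmoothPoincare4.SmoothPoincare4.Theorems.MargerinRails

open Literature.Geometry.Riemannian
open Literature.Geometry.Lorentzian Literature.Geometry.Lorentzian.PseudoRiemannianMetric

/-- **STUB 4.B1 — HAMILTON'S GRADIENT ESTIMATES FOR THE SCALAR CURVATURE (Hamilton 1982,
Thm. 11.1 with Lemmas 11.6–11.9, and Lemma 17.4; Huisken 1985, Thm. 4.1 with Lemma 4.3; dimension 4).**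
Along a Ricci flow of Riemannian metrics on `[0, T)` on a closed 4-manifold with the invariant pinching
`m ≤ R`, `|W|² + 2|E|² ≤ K R^{2−τ}`: (i) for every `η > 0` there is `C` with `|∇R|² ≤ η R³ + C` on
`M × [0, T)`; (ii) if moreover `c₁ ≤ (T−t)R ≤ c₂` on `[t₁, T)` with `c₁ > 0`, then
`|∇R|² ≤ C (T−t)^{δ−3}` there for some `δ > 0`. Assembly of H0–H4: positivity of `R` from the
pinching (`roundness_dictionary`), restriction of the flow to `[0, T']` (`IsRicciFlow.mono`) and
restart at `t₁` (`isRicciFlow_restart`), the `η = 0` instance of H0 for Hamilton's `F` itself.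
[cite: Hamilton1982, §11, Thm. 11.1, Lemmas 11.6–11.9; §17, Lemma 17.4] [cite: Huisken1985, §4, Thm. 4.1, Lemma 4.3] -/
theorem stub_gradientEstimates :
    ∀ (M : Type) [TopologicalSpace M] [T2Space M] [SecondCountableTopology M]
      [ChartedSpace (EuclideanSpace ℝ (Fin 4)) M] [IsManifold (𝓡 4) ∞ M] [CompactSpace M]
      (g : ℝ → PseudoRiemannianMetric (𝓡 4) ∞ (EuclideanSpace ℝ (Fin 4)) (TangentSpace (𝓡 4) : M → Type _))
      (cov : ℝ → CovariantDerivative (𝓡 4) (EuclideanSpace ℝ (Fin 4)) (TangentSpace (𝓡 4) : M → Type _))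
      (T m K τ : ℝ), 0 < T → 0 < m → 0 < K → 0 < τ → τ ≤ 1 →
      IsRicciFlow g cov (Ico 0 T) → (∀ t ∈ Ico 0 T, (g t).IsRiemannian) →
      (∀ t ∈ Ico 0 T, ∀ [(g t).HasLeviCivita] (x : M),
        m ≤ (g t).scalarCurvature x ∧
          (g t).weylNormSq x + 2 * (g t).tracelessRicciNormSq x ≤
            K * (g t).scalarCurvature x ^ (2 - τ)) →
      (∀ η : ℝ, 0 < η → ∃ C : ℝ, ∀ t ∈ Ico 0 T, ∀ x : M,
        (g t).gradSq (fun y ↦ (g t).scalarCurvatureWith (cov t) y) x ≤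
          η * (g t).scalarCurvatureWith (cov t) x ^ 3 + C) ∧
      (∀ (t₁ c₁ c₂ : ℝ), t₁ ∈ Ico 0 T → 0 < c₁ →
        (∀ t ∈ Ico t₁ T, ∀ x : M, c₁ ≤ (T - t) * (g t).scalarCurvatureWith (cov t) x ∧
          (T - t) * (g t).scalarCurvatureWith (cov t) x ≤ c₂) →
        ∃ δ C : ℝ, 0 < δ ∧ ∀ t ∈ Ico t₁ T, ∀ x : M,
          (g t).gradSq (fun y ↦ (g t).scalarCurvatureWith (cov t) y) x ≤ C * (T - t) ^ (δ - 3)) := by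
  intro M _ _ _ _ _ _ g cov T m K τ hT hm hK hτ0 hτ1 hflow hRiem hpinch
  -- positivity of `R` along the flow
  have hRpos : ∀ t ∈ Ico 0 T, ∀ y : M, 0 < (g t).scalarCurvatureWith (cov t) y := fun t ht y ↦
    hm.trans_le (roundness_dictionary hflow hRiem hpinch ht y).1
  -- restriction of the flow to `[0, T']` and restart at `t₁`
  have hsub : ∀ {T' : ℝ}, T' < T → Icc 0 T' ⊆ Ico 0 T := fun hT' s hs ↦ ⟨hs.1, hs.2.trans_lt hT'⟩
  have hres : ∀ {t₁ w : ℝ}, 0 ≤ t₁ → t₁ + w < T →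
      IsRicciFlow (fun s ↦ g (s + t₁)) (fun s ↦ cov (s + t₁)) (Icc 0 w) := fun ht₁ hw ↦
    isRicciFlow_restart hflow ht₁ fun s hs ↦ ⟨hs.1, by linarith [hs.2]⟩
  constructor
  · refine helper_gradientBound_of_evolution M g cov T m K τ hT hm hK hτ0 hτ1 hflow hRiem hpinch
      (fun T' hT' hT'T ↦ helper_hamiltonSmoothGradSq M g cov T' hT' (hflow.mono (hsub hT'T)))
      (fun T' hT' hT'T ↦ helper_hamiltonSmoothRicciNormSq M g cov T' hT' (hflow.mono (hsub hT'T)))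
      ?_
    intro Λ η T' hΛ hT' hT'T t ht x hΛx
    exact helper_hamiltonEvolution M g cov T' Λ η hT' hΛ (hflow.mono (hsub hT'T))
      (fun s hs ↦ hRiem s (hsub hT'T hs)) t ht (hRpos t (hsub hT'T ht)) x hΛx
  · refine helper_gradientDecay_of_evolution M g cov T m K τ hT hm hK hτ0 hτ1 hflow hRiem hpinch
      ?_ ?_ ?_ ?_
    · intro t₁ w ht₁ hw hwT
      exact (hres ht₁ hwT).contMDiffOn_scalarCurvatureWith
    · intro t₁ w ht₁ hw hwT
      exact helper_hamiltonSmoothGradSq M (fun s ↦ g (s + t₁)) (fun s ↦ cov (s + t₁)) w hw (hres ht₁ hwT)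
    · intro t₁ w ht₁ hw hwT
      exact helper_hamiltonSmoothRicciNormSq M (fun s ↦ g (s + t₁)) (fun s ↦ cov (s + t₁)) w hw
        (hres ht₁ hwT)
    · intro Λ t₁ w hΛ ht₁ hw hwT s hs x hΛx
      have hmem : ∀ r ∈ Icc 0 w, r + t₁ ∈ Ico 0 T := fun r hr ↦
        ⟨by linarith [hr.1], by linarith [hr.2]⟩
      have key := helper_hamiltonEvolution M (fun r ↦ g (r + t₁)) (fun r ↦ cov (r + t₁)) w Λ 0 hw hΛ
        (hres ht₁ hwT) (fun r hr ↦ hRiem _ (hmem r hr)) s hs (hRpos _ (hmem s hs)) x hΛx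
      simp only [zero_mul, sub_zero, mul_zero, zero_sub, neg_mul, one_mul] at key
      simpa only [neg_mul, one_mul] using key

end Summit.SmoothPoincare4.SmoothPoincare4.Theorems.MargerinRails

end
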